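import Summits.CriticalPhenomena.SAWScalingLimit.Theses.SAWRenewalTightness
import Summits.CriticalPhenomena.SAWScalingLimit.Theorems.ConfinementPositivity.Negative.LoadBearing
import Summits.CriticalPhenomena.SAWScalingLimit.Theorems.ConfinementPositivity.Negative.Nested
import Summits.CriticalPhenomena.SAWScalingLimit.Theorems.ConfinementPositivity.Negative.SamePtFalse
import Summits.CriticalPhenomena.SAWScalingLimit.Theorems.SAWRenewalTightnessShellCrossingBoundConfinementOfScalingLimit
import Summits.CriticalPhenomena.SAWScalingLimit.Theorems.SAWRenewalTightnessEventualTightConfinementRatioMono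

/-!
# Disproof of `ConfinementPositivity` (stmt-CriticalPhenomena-17587) — findings (cycle 1, v2)

Standing disprover (cdisprove) work file for the crux
`Summit.CriticalPhenomena.SAWScalingLimit.Theses.SAWRenewalTightness.ConfinementPositivity`
(route SAWRenewalTightness, child of `EventualTight`; with `BulkShellTight` it gives the parent by
the LANDED glue `EventualTightOfSubs`).  The crux: for socketed nested Jordan pairs `D' ⊆ D`
(same marked points `a, b`; `D ∩ (B(a,d) ∪ B(b,d)) ⊆ D'`) and every endpoint approximation of
`D'`, the critical SAW of `D_δ` from `a_δ` to `b_δ` is a `D'_δ`-walk with probability `≥ c > 0`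
for all `δ ∈ (0, δ₀]`.

## §0 Verdict: RESISTS — no kill is possible short of refuting the summit conjunct

* `Theorems.confinementPositivity_of_scalingLimit` (LANDED): the crux follows from
  `SAWScalingLimit` (the summit conjunct, verbatim) plus hull-avoidance positivity of the chordal
  SLE_{8/3} law, both as hypotheses; the second is continuum folklore (restriction formula
  `P[γ ∩ A = ∅] = Φ_A'(0)^{5/8} > 0`; `cl(D ∖ D')` is a hull at positive distance from `a, b`
  by the sockets; SLE_{κ≤4} touches `∂D` only at its endpoints).  So `¬ ConfinementPositivity`
  would refute `SAWScalingLimit` as typed.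
* `Theorems.confinementPositivity_iff_partitionRatio` (LANDED): the crux IS the RSW-type ratio
  bound `c · Z_D(a_δ,b_δ) ≤ Z_{D'}(a_δ,b_δ)`, `δ ≤ δ₀`; heuristically the ratio tends to
  `P[SLE_{8/3} in D avoids D ∖ D'] > 0` — the boundary one-leg factors `δ^{5/8}` at `a_δ, b_δ`
  CANCEL because `D` and `D'` agree near `a, b`: this is exactly what the sockets buy, and §2
  proves that without them the ratio does go to `0`.
* `Theorems.confinementRatio_mono` (LANDED): monotone in nested quadruples.

## §1 Junk-model attacks that FAIL, and why (so nobody repeats them)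

1. ZERO LAW via the largest-component convention (`meshDomain` = union of the max-cardinality
   components of `Ω ∩ δℤ²`): could `a_δ ∈ D'_δ` fail to lie in `D_δ` along `δ → 0`?  NO: for
   nested Jordan domains `D'_δ ⊆ D_δ` for all small `δ` (`JordanDomain.exists_forall_meshDomain_subset`),
   stray components have vanishing extent (`JordanDomain.mul_sub_lt_of_stray`,
   `JordanDomain.exists_mem_meshDomain_of_reachable`), and the law of `D_δ` is a probability
   measure below the reachability threshold (`eventually_isProbabilityMeasure_law`).  A competing
   component would need `≳ area/δ²` sites accumulating on a positive-area, non-locally-connected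
   part of `∂D` — impossible for a Jordan curve (paper analysis, NOTES.md §A).
2. INVISIBLE WALLS (`meshGraph` tests closed EDGES against `cl Ω` only; a slit is invisible to
   edges): irrelevant for Jordan domains (a 2-D thorn is crossed only through its interior).
3. `D' = D`: HOLDS with `c = 1` (`LoadBearing.diag`).  4. LARGE `δ`: excluded by `∃ δ₀`.
5. WILD `∂D'` inside `D`: any open connected `D'` contains a fixed tube between the sockets, so
   no FIXED obstacle away from `a, b` starves the lattice at all small `δ` (tube argument).
   Starvation AT a marked point is possible — and is exactly what the sockets forbid (§2).

## §2 Load-bearing hypotheses — EVERY hypothesis of the crux is now certified load-bearing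

| hypothesis deleted                          | status  | theorem (all in `Theorems/ConfinementPositivity/Negative/`) |
|---------------------------------------------|---------|------|
| `IsEndpointApprox D' a b`                    | LANDED (earlier seat) | `LoadBearing.false_without_endpointApprox` — far endpoints, zero law |
| quantifier swap `∃ c δ₀ ∀ (a,b)`             | LANDED (earlier seat) | `LoadBearing.not_uniformThreshold` — splice; `δ₀` depends on the approximation |
| `D'.carrier ⊆ D.carrier`                     | LANDED p145803 | `Nested.false_without_nested` — inscribed triangle `(Δ;1,-1)` vs `(𝔻;1,-1)`, real-axis approximation, `a_δ ∉ Δ_δ`, zero law |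
| sockets `D ∩ (B(a,d) ∪ B(b,d)) ⊆ D'`          | LANDED (this cycle) | `SocketsFalse.false_without_sockets` — CUSP witness, see §3 |
| `0 < d`                                       | LANDED (this cycle) | `SocketsFalse.false_without_radiusPos` (`d = 0`: empty sockets) |
| `D'.pt 0 = D.pt 0`                            | LANDED (this cycle) | `SamePtFalse.false_without_samePt0` — same cusp pair, `D` marked at `1/2 + i/64` on the common arc (sockets `d = 1/128` hold), `D'` marked at the cusp tip |
| `D'.pt 1 = D.pt 1`                            | symmetric (mirror `x ↦ 1 - x`, walk reversal); not typed |

Morals for provers (quantitative content of the table): (i) `c` must depend on the socket radius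
`d` and degenerate as `∂D'` and `∂D` separate near a marked point — for the cusp,
`Z_{D'}/Z_D ≤ x_c^{-4}/(4k-1)` at `δ = 1/k²`, i.e. `c(δ) ≲ δ^{1/2}`; (ii) the sockets must sit
at the points the approximation converges to (pt-equality); (iii) nesting is used at least
through `D'_δ ⊆ D_δ` eventually; (iv) the threshold `δ₀` depends on the approximation.  Any
proof therefore has to use the AGREEMENT of `D` and `D'` near BOTH marked points quantitatively
— the lattice shadow of the cancellation of the boundary one-leg factor `δ^{5/8}`.

## §3 The cusp mechanism (series `Cusp1Domains … Cusp5Injection`, `SocketsFalse`, all LANDED)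

`ψ(x+iy) = x + i y|y|` (homeomorphism of `ℂ`, `exists_cuspHomeomorph`); `D' = ψ(W')`,
`D = ψ(W)` for the convex `W' = {|y| < x/4, x < 1}`, `W = {0<x<1, -1<y<x/4}` turned into
Dobrushin domains by `exists_dobrushinDomain_of_convex` (gauge rescaling of the disc; reusable
for ANY bounded convex open set with two frontier points), marked at `0, 1` (fixed by `ψ`):
`D' = {0<x<1, |y|<x²/16} ⊆ D = {0<x<1, -1<y<x²/16}` (`exists_cuspPair`).  Both are GRAPH STRIPS
(`Cusp2Lattice`: `Ω_δ = Ω ∩ δℤ²`, all edges, honest approximation `a_δ=(1,0)`,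
`b_δ=(⌈δ⁻¹⌉-1,0)`).  At `δ = 1/k²` the cusp's columns `1 … 4k` are single sites (`16k²|n| < m²`
fails): every cusp SAW from `a_δ` starts with the bare run to `(4k,0)` (`cusp_forced_run`);
the `4k-1` detours `(1,0)→(1,-1)→…→(j,-1)→(j,-2)→…→(4k,-2)→(4k,-1)→(4k,0)` in `D ∖ D'` glued to
the same remainders give distinct `D`-SAWs with `4` more steps (`exists_detour_injection`), so
`(4k-1) x_c⁴ Z_{D'} ≤ Z_D` (`fat_weight_ge`), against `c Z_D ≤ Z_{D'}` from the crux at `δ`.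

## §4 Natural strengthenings (status)

* `c` uniform in `D'` for fixed `(D, d)`: FALSE in the continuum (neck of width `w → 0`), no
  lattice proof attempted (needs SAW estimates); `c = 1`: trivially false; threshold uniform in
  `(a,b)`: FALSE, landed.  Nothing else cheap remains: the crux is now a pure RSW bet.

Prose only in docstrings; everything below is kernel-checked (no `sorry`). [folklore]
-/

noncomputable section

namespace Summit.CriticalPhenomena.SAWScalingLimit.Cruxes.ConfinementPositivity.Disproof

open MeasureTheory Set Metric Filter Topology
open Literature.Probability.RandomPlanarGeometry Literature.Probability.LatticeModels
open Summit.CriticalPhenomena.SAWScalingLimit.Theses.SAWRenewalTightness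
open Summit.CriticalPhenomena.SAWScalingLimit.Theorems.SubseqIdentification.Negative
open Summit.CriticalPhenomena.SAWScalingLimit.Theorems.ConfinementPositivity.Negative

/-! ### §0 Calibration: the crux body, verbatim, and what is LANDED about it -/

/-- The crux is literally the body below (sanity: `Iff.rfl`). [folklore] -/
theorem confinementPositivity_iff :
    ConfinementPositivity ↔
    ∀ (D D' : DobrushinDomain) (a b : ℝ → Site 2) (d : ℝ), 0 < d → D'.carrier ⊆ D.carrier →
      D'.pt 0 = D.pt 0 → D'.pt 1 = D.pt 1 →
      D.carrier ∩ (Metric.ball (D.pt 0) d ∪ Metric.ball (D.pt 1) d) ⊆ D'.carrier →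
      SAW.IsEndpointApprox D' a b →
      ∃ c δ₀ : ℝ, 0 < c ∧ 0 < δ₀ ∧ ∀ δ ∈ Set.Ioc (0 : ℝ) δ₀,
        ENNReal.ofReal c ≤ SAW.law D.carrier δ (a δ) (b δ)
          {γ | ∃ γ' : SAW.DomainSAW D'.carrier δ (a δ) (b δ), γ'.walk.support = γ.walk.support} :=
  Iff.rfl

/-- **Why it resists.** The crux is implied by the summit conjunct `SAWScalingLimit` together with
hull-avoidance positivity of the SLE_{8/3} law (LANDED calibration, restated on the crux name).
[folklore] -/
theorem confinementPositivity_of_scalingLimit'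
    (hSL : SAW.SAWScalingLimit)
    (hPos : ∀ (D D' : DobrushinDomain) (μ : MeasureTheory.Measure (CurveClass ℂ)),
      D'.carrier ⊆ D.carrier → D'.pt 0 = D.pt 0 → D'.pt 1 = D.pt 1 →
      D.pt 0 ∉ closure (D.carrier \ D'.carrier) → D.pt 1 ∉ closure (D.carrier \ D'.carrier) →
      IsSLELaw ((8 : NNReal) / 3) D μ →
        0 < μ (CurveClass.rangeSubset ((closure (D.carrier \ D'.carrier))ᶜ))) :
    ConfinementPositivity :=
  Theorems.confinementPositivity_of_scalingLimit hSL hPos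

/-- **Ratio form** (LANDED audit, restated on the crux name). [folklore] -/
theorem confinementPositivity_iff_ratio :
    ConfinementPositivity ↔
    ∀ (D D' : DobrushinDomain) (a b : ℝ → Site 2) (d : ℝ), 0 < d →
      D'.carrier ⊆ D.carrier → D'.pt 0 = D.pt 0 → D'.pt 1 = D.pt 1 →
      D.carrier ∩ (Metric.ball (D.pt 0) d ∪ Metric.ball (D.pt 1) d) ⊆ D'.carrier →
      SAW.IsEndpointApprox D' a b →
        ∃ c δ₀ : ℝ, 0 < c ∧ 0 < δ₀ ∧ ∀ δ ∈ Set.Ioc (0 : ℝ) δ₀,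
          ENNReal.ofReal c * SAW.weight D.carrier δ (a δ) (b δ) Set.univ ≤
            SAW.weight D'.carrier δ (a δ) (b δ) Set.univ :=
  Theorems.confinementPositivity_iff_partitionRatio

/-! ### §2 Load-bearing analysis: the crux with one hypothesis deleted, each FALSE -/

/-- The crux with `IsEndpointApprox D' a b` deleted. [folklore] -/
def WithoutEndpointApprox : Prop :=
  ∀ (D D' : DobrushinDomain) (a b : ℝ → Site 2) (d : ℝ), 0 < d → D'.carrier ⊆ D.carrier →
    D'.pt 0 = D.pt 0 → D'.pt 1 = D.pt 1 →
    D.carrier ∩ (Metric.ball (D.pt 0) d ∪ Metric.ball (D.pt 1) d) ⊆ D'.carrier →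
    ∃ c δ₀ : ℝ, 0 < c ∧ 0 < δ₀ ∧ ∀ δ ∈ Set.Ioc (0 : ℝ) δ₀,
      ENNReal.ofReal c ≤ SAW.law D.carrier δ (a δ) (b δ)
        {γ | ∃ γ' : SAW.DomainSAW D'.carrier δ (a δ) (b δ), γ'.walk.support = γ.walk.support}

/-- The crux with the nesting hypothesis `D'.carrier ⊆ D.carrier` deleted. [folklore] -/
def WithoutNested : Prop :=
  ∀ (D D' : DobrushinDomain) (a b : ℝ → Site 2) (d : ℝ), 0 < d →
    D'.pt 0 = D.pt 0 → D'.pt 1 = D.pt 1 →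
    D.carrier ∩ (Metric.ball (D.pt 0) d ∪ Metric.ball (D.pt 1) d) ⊆ D'.carrier →
    SAW.IsEndpointApprox D' a b →
    ∃ c δ₀ : ℝ, 0 < c ∧ 0 < δ₀ ∧ ∀ δ ∈ Set.Ioc (0 : ℝ) δ₀,
      ENNReal.ofReal c ≤ SAW.law D.carrier δ (a δ) (b δ)
        {γ | ∃ γ' : SAW.DomainSAW D'.carrier δ (a δ) (b δ), γ'.walk.support = γ.walk.support}

/-- The crux with the socket hypothesis deleted (the now idle binder `d` kept). [folklore] -/
def WithoutSockets : Prop :=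
  ∀ (D D' : DobrushinDomain) (a b : ℝ → Site 2) (d : ℝ), 0 < d → D'.carrier ⊆ D.carrier →
    D'.pt 0 = D.pt 0 → D'.pt 1 = D.pt 1 →
    SAW.IsEndpointApprox D' a b →
    ∃ c δ₀ : ℝ, 0 < c ∧ 0 < δ₀ ∧ ∀ δ ∈ Set.Ioc (0 : ℝ) δ₀,
      ENNReal.ofReal c ≤ SAW.law D.carrier δ (a δ) (b δ)
        {γ | ∃ γ' : SAW.DomainSAW D'.carrier δ (a δ) (b δ), γ'.walk.support = γ.walk.support}

/-- The crux with `0 < d` deleted. [folklore] -/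
def WithoutRadiusPos : Prop :=
  ∀ (D D' : DobrushinDomain) (a b : ℝ → Site 2) (d : ℝ), D'.carrier ⊆ D.carrier →
    D'.pt 0 = D.pt 0 → D'.pt 1 = D.pt 1 →
    D.carrier ∩ (Metric.ball (D.pt 0) d ∪ Metric.ball (D.pt 1) d) ⊆ D'.carrier →
    SAW.IsEndpointApprox D' a b →
    ∃ c δ₀ : ℝ, 0 < c ∧ 0 < δ₀ ∧ ∀ δ ∈ Set.Ioc (0 : ℝ) δ₀,
      ENNReal.ofReal c ≤ SAW.law D.carrier δ (a δ) (b δ)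
        {γ | ∃ γ' : SAW.DomainSAW D'.carrier δ (a δ) (b δ), γ'.walk.support = γ.walk.support}

/-- The crux with `D'.pt 0 = D.pt 0` deleted. [folklore] -/
def WithoutSamePt0 : Prop :=
  ∀ (D D' : DobrushinDomain) (a b : ℝ → Site 2) (d : ℝ), 0 < d → D'.carrier ⊆ D.carrier →
    D'.pt 1 = D.pt 1 →
    D.carrier ∩ (Metric.ball (D.pt 0) d ∪ Metric.ball (D.pt 1) d) ⊆ D'.carrier →
    SAW.IsEndpointApprox D' a b →
    ∃ c δ₀ : ℝ, 0 < c ∧ 0 < δ₀ ∧ ∀ δ ∈ Set.Ioc (0 : ℝ) δ₀,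
      ENNReal.ofReal c ≤ SAW.law D.carrier δ (a δ) (b δ)
        {γ | ∃ γ' : SAW.DomainSAW D'.carrier δ (a δ) (b δ), γ'.walk.support = γ.walk.support}

/-- Any proof must use `IsEndpointApprox` (LANDED, earlier seat). [folklore] -/
theorem confinementPositivity_false_without_endpointApprox : ¬ WithoutEndpointApprox :=
  false_without_endpointApprox

/-- The threshold `δ₀` cannot be chosen before the approximation (LANDED, earlier seat). [folklore] -/
theorem confinementPositivity_not_uniformThreshold :
    ¬ ∀ (D D' : DobrushinDomain) (d : ℝ), 0 < d → D'.carrier ⊆ D.carrier →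
      D'.pt 0 = D.pt 0 → D'.pt 1 = D.pt 1 →
      D.carrier ∩ (Metric.ball (D.pt 0) d ∪ Metric.ball (D.pt 1) d) ⊆ D'.carrier →
      ∃ c δ₀ : ℝ, 0 < c ∧ 0 < δ₀ ∧ ∀ (a b : ℝ → Site 2), SAW.IsEndpointApprox D' a b →
        ∀ δ ∈ Set.Ioc (0 : ℝ) δ₀,
        ENNReal.ofReal c ≤ SAW.law D.carrier δ (a δ) (b δ)
          {γ | ∃ γ' : SAW.DomainSAW D'.carrier δ (a δ) (b δ), γ'.walk.support = γ.walk.support} :=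
  not_uniformThreshold

/-- **Nesting is load-bearing** (LANDED this cycle, `Negative/Nested.lean`, p145803). [folklore] -/
theorem confinementPositivity_false_without_nested : ¬ WithoutNested :=
  false_without_nested

/-- **The sockets are load-bearing** (LANDED this cycle, `Negative/SocketsFalse.lean`: the cusp
witness of §3). [folklore] -/
theorem confinementPositivity_false_without_sockets : ¬ WithoutSockets :=
  false_without_sockets

/-- **`0 < d` is load-bearing** (LANDED this cycle). [folklore] -/
theorem confinementPositivity_false_without_radiusPos : ¬ WithoutRadiusPos :=
  false_without_radiusPos

/-- **`D'.pt 0 = D.pt 0` is load-bearing** (LANDED this cycle, `Negative/SamePtFalse.lean`).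
[folklore] -/
theorem confinementPositivity_false_without_samePt0 : ¬ WithoutSamePt0 :=
  false_without_samePt0

/-! ### §3 The cusp mechanism, quantitative form (re-exported for ideators/provers) -/

/-- **Tightness lemma of the cusp.** At `δ = 1/k²` (`k ≥ 5`), for the cusp/fat pair of graph
strips and walks from `a_δ = (1,0)` to an axis site `(B, 0)` beyond the corridor,
`(4k - 1) · x_c⁴ · Z_{D'} ≤ Z_D` — the ratio `Z_{D'}/Z_D` of critical partition functions
is `O(δ^{1/2})` when the boundaries separate at the marked point like a cusp (LANDED,
`Cusp5Injection.fat_weight_ge`). [folklore] -/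
theorem cusp_ratio_decay {Ωc Ωf : Set ℂ}
    (hC : ∀ z : ℂ, z ∈ Ωc ↔ 0 < z.re ∧ z.re < 1 ∧ -(z.re ^ 2 / 16) < z.im ∧ z.im < z.re ^ 2 / 16)
    (hF : ∀ z : ℂ, z ∈ Ωf ↔ 0 < z.re ∧ z.re < 1 ∧ -1 < z.im ∧ z.im < z.re ^ 2 / 16)
    {k : ℕ} (hk : 5 ≤ k) {B : ℤ} (hB : 4 * (k : ℤ) + 1 ≤ B) :
    ((4 * k - 1 : ℕ) : ENNReal) * ENNReal.ofReal (SAW.criticalFugacity ^ 4) *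
        SAW.weight Ωc (((k : ℝ) ^ 2)⁻¹) ![1, 0] ![B, 0] Set.univ ≤
      SAW.weight Ωf (((k : ℝ) ^ 2)⁻¹) ![1, 0] ![B, 0] Set.univ :=
  fat_weight_ge hC hF hk hB

end Summit.CriticalPhenomena.SAWScalingLimit.Cruxes.ConfinementPositivity.Disproof

end
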